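import Summits.BirchSwinnertonDyer.BirchSwinnertonDyer.Theorems.PrintX9HeegnerRankOne
import Summits.BirchSwinnertonDyer.BirchSwinnertonDyer.Theorems.PrintX9HeegnerIMCLink
import Literature.NumberTheory.EllipticCurves.MatarNekovar2019.IrreducibleOverQuadraticField
import HarnessLib

/-!
# Class X9, analytic rank ONE, the HEEGNER ROAD — pair level: the Hoffstein–Luo field, the Manin-unit
# datum, the Néron model of the twist with its X9 transports; the anticyclotomic control link
# PUBLISHED (Jetchev–Skinner–Wan 2017 Thm. 3.3.1); and the two printed-shape inputs (irred_𝒦) and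
# (IMC≥∘BDP)ᵍ DISCHARGED from Matar–Nekovář 2019 Prop. 5.26 (2) and Burungale–Castella–Skinner 2025
# Thm. 1.2.4 (a) + Prop. 4.2.2 ∘ CGLS 2022 Thm. 5.1.3
# (cell `bsd-print-x9`, prover seat p4; companion of `PrintX9HeegnerRankOne.lean` and `PrintX9HeegnerIMCLink.lean`)

HONEST FRAMING (cell `run/shared/lean/pub/bsd-print-x9/`, D-0131 print tier; verbatim from the
charter): a leaf counts only when its class theorem is in the kernel BY NAME, flag-free; Literature
named facts are statement-only with cite tags; every imported theorem carries its printed hypotheses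
verbatim; a stall becomes a NAMED residual crux. THEOREMS ONLY (no definition, no named fact, no
`sorry`); every published theorem enters as one of the tree's existing named Literature facts BY NAME;
every unproved statement enters as an EXPLICIT binder. Nothing about any particular curve is asserted;
no label changes; `BSDpOnClassX9` (rung K6) is NOT claimed closed here (currency: crux-record — every
theorem below is conditional on the K6 typed rank-`0` engine `IntegralMainConjectureOnClassX9`).

See the module docstring of `PrintX9HeegnerRankOne.lean` for the road (BCS 2025 Cor. 1.3.1 (`r = 1`)
re-run WITHOUT (sur): STEP U = Matar–Nekovář 2019, twist-closure of class X9, the twist's rank-`0`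
input = the K6 typed engine `IntegralMainConjectureOnClassX9`, NO Schneider certificate). This file:

* §4 `X9.bsdp_rankOne_of_indexLowerBoundAt_of_x9IntegralMainConjecture` — the X9 twin of
  `bsdp_rankOne_of_indexLowerBoundAt_of_columnMainConjecture` (row C2): at an X9 pair with
  `ord_{s=1} L(E,s) = 1` and `p ∤ ∏_ℓ c_ℓ(E)`, `BSD(E,p)` from the published facts, the K6 typed
  rank-`0` engine (consumed at the twist only) and STEP L at the pair's BCS Heegner data (binder `hL`).
* §5 `X9.bsdp_rankOne_of_thm331_of_x9IntegralMainConjecture` — the X9 twin of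
  `bsdp_rankOne_of_thm331_of_columnMainConjecture_odd`: STEP L fed by JSW Thm. 3.3.1 (binder
  (irred_𝒦) `hIrrK`, JSW's own hypothesis) and the ONE typed anticyclotomic input (IMC≥∘BDP)ᵍ (`hLA`,
  `X11b.IMCLowerWaldspurgerOnTreeGoodAt`, JSW/Castella letter).
* §5c `X9.bsdp_rankOne_of_thm331_of_thm124a_of_x9IntegralMainConjecture` — BOTH binders DISCHARGED
  from print: (irred_𝒦) at the Heegner field by Matar–Nekovář 2019 Prop. 5.26 (2)
  (`MatarNekovar2019.prop526_hasIrreducibleModPGaloisRep_baseChange`: `(d_K, N_E) = 1` under (Heeg),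
  `p ≠ 2`, (irr_ℚ) ⇒ (irr_K)), and (IMC≥∘BDP)ᵍ by `PrintX9HeegnerIMCLink.lean` §4 (BCS 2025 Thm.
  1.2.4 (a) + Prop. 4.2.2 ∘ CGLS 2022 Thm. 5.1.3 — the fact
  `thm124a_prop422_thm513_generator_constantCoeff`, flags `BCS25-124a+422-mu-composite` /
  `BCS25-IMC-equiv@BSTW` — + JSW Thm. 3.3.1 + the σ-bridge). Result: at every X9 pair of analytic rank
  one with `p ∤ ∏_ℓ c_ℓ(E)`, `BSD(E,p)` from PUBLISHED named facts and the K6 typed rank-`0` engine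
  ALONE — no Schneider certificate, no (im), no (sur).

References: [BurungaleCastellaSkinner2025] Thm. 1.2.4 (a), Prop. 4.2.2, Cor. 1.3.1 (proof p. 4);
[MatarNekovar2019] Thm. 0.3, §0.11, Prop. 5.26 (2); [JetchevSkinnerWan2017] Thm. 3.3.1, §7.4.1;
[CastellaGrossiLeeSkinner2022] Thm. 5.1.3; [HoffsteinLuo1997]; [Mazur1978] Cor. 4.1;
[Miller2011LMS] Def. 1.1.
-/

set_option linter.dupNamespace false
set_option autoImplicit false

noncomputable section

open scoped Classical MatrixGroups ModularForm

open CongruenceSubgroup WeierstrassCurve NumberField IsDedekindDomain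
  Literature.NumberTheory.EllipticCurves Literature.NumberTheory.EllipticCurves.ModularForms
  Literature.NumberTheory.EllipticCurves.BurungaleCastellaSkinner2025
  Literature.NumberTheory.EllipticCurves.JetchevSkinnerWan2017
  Summit.BirchSwinnertonDyer.BirchSwinnertonDyer.Theorems.Rank1ResidualX1Defs
  Summit.BirchSwinnertonDyer.Rank1Residual

open Literature.NumberTheory.EllipticCurves.Rank1Residual (GoodOrd Irr Surj BigIm
  norm_periodRatio_eq_one pPart_of_bsdp not_dvd_discr_of_split
  exists_admissibleField_of_rootNumber_eq_neg_one)

namespace Summit.BirchSwinnertonDyer.BirchSwinnertonDyer.Rank1Residual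

/-! ### §4 Rank one at the pair, class X9: the field, the datum, the twist model and its X9 transports -/

/-- **Rank one on class X9 at the pair, from the K6 typed rank-`0` engine and STEP L.** For `(E,p)`
of class X9 (`Rank1Residual.ClassX9 W p`: non-CM, `p ≥ 5` good ordinary, `E[p]` irreducible,
`ρ̄_{E,p}` NOT surjective) with `ord_{s=1} L(E,s) = 1` and `p ∤ ∏_ℓ c_ℓ(E)`: `BSD(E,p)` from the
PUBLISHED named facts — Gross–Zagier (`hGZ`), Kolyvagin (`hKo`), Matar–Nekovář 2019 (`hMN`, Kolyvagin's
bound under irreducibility), Greenberg 1999 Thm. 4.1 (`hGr`), GZK (`hGZK`), modularity (`hmod`,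
`hpar`, `hnf`), Hoffstein–Luo 1997 (`hHL`: the field), Mazur 1978 Cor. 4.1 (`hMaz`, Manin constant)
with the Néron mapping property (`hNS`), the period unit (`h5`) — and TWO typed inputs: `hIMC`, the
sister route's typed rank-`0` engine `IntegralMainConjectureOnClassX9` (consumed ONLY at the twist
`E^{(d_K)}`, an X9 pair of analytic rank `0` by §1 `classX9_twist_model`), and `hL`, STEP L
`X11b.IndexLowerBoundAt W p K P` for THIS pair at every Manin-unit classical Heegner datum over a field
`K` with `d_K` ODD, `d_K < −4`, every `ℓ ∣ N` split and `p` split — EXACTLY the data (disc), (Heeg),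
(spl) of BCS 2025 Thm. 1.2.4. Proof = the X9 twin of `bsdp_rankOne_of_indexLowerBoundAt_of_columnMainConjecture`
(row C2): sign `−1` (modularity); Hoffstein–Luo supplies `K` (`exists_admissibleField_of_rootNumber_eq_neg_one`);
`#𝓞_K^× = 2`; `p ∤ d_K`; the Manin-unit datum at `p ∤ N` (`X11b.exists_maninDatum_of_good`); a
globally minimal model of the twist (Néron) of class X9 (`classX9_twist_model`) whose typed main
conjecture is `hIMC` read in Mazur's shape (`mazurMainConjecture_of_integralMainConjectureOnClassX9`);
the Tamagawa / unit side conditions as in row C2; then §3. NO (sur), NO (im), NO Schneider.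
[cite: BurungaleCastellaSkinner2025, Cor. 1.3.1 (r = 1) and its proof (p. 4); Thm. 1.2.4]
[cite: MatarNekovar2019, Thm. 0.3 and §0.11] [cite: HoffsteinLuo1997, Theorem (§1, pp. 435–436)]
[cite: Mazur1978, Cor. 4.1] [cite: JetchevSkinnerWan2017, §7.4.1 (pp. 30–31) (the shape of the descent)]
[cite: Miller2011LMS, Def. 1.1] -/
theorem X9.bsdp_rankOne_of_indexLowerBoundAt_of_x9IntegralMainConjecture
    -- published inputs (named facts of the tree)
    (hGZ : ∀ (N : ℕ) [NeZero N] (W : WeierstrassCurve ℚ) (K : Type) [Field K] [NumberField K],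
      gross_zagier N W K)
    (hKo : ∀ (N : ℕ) [NeZero N] (W : WeierstrassCurve ℚ) (K : Type) [Field K] [NumberField K],
      kolyvagin N W K)
    (hMN : ∀ (N : ℕ) [NeZero N] (W : WeierstrassCurve ℚ) (K : Type) [Field K] [NumberField K],
      MatarNekovar2019.thm03_padicValNat_card_sha_le_of_irreducible N W K)
    (hGr : greenberg_charValue_rankZero) (hGZK : rank_eq_analyticRank_of_analyticRank_le_one)
    (hmod : hasEntireLFunction_rat) (hpar : nonempty_modularParametrizationData)
    (hnf : exists_isNewformOf) (hHL : HoffsteinLuo1997_exists_twist_L_one_ne_zero)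
    (hMaz : mazur_not_dvd_maninConstant_of_odd) (hNS : integral_neronScaling_of_isGloballyMinimal)
    (h5 : realPeriodRat_eq_unit_mul_plusPeriod)
    -- the pair
    (W : WeierstrassCurve ℚ) [W.IsElliptic] [W.IsGloballyMinimal] (p : ℕ) [Fact p.Prime]
    (hX9 : ClassX9 W p) (hr : W.analyticRank = 1) (htam0 : ¬ p ∣ W.tamagawaProduct)
    -- the K6 typed rank-`0` engine (used at the twist only)
    (hIMC : IntegralMainConjectureOnClassX9)
    -- the typed input (STEP L) for this pair at every Manin-unit Heegner datum over a BCS field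
    (hL : ∀ (N : ℕ) [NeZero N] (K : Type) [Field K] [NumberField K]
      (Dt : ModularParametrizationData W N) (H : HeegnerDatum N (NumberField.discr K)) (ι : K →+* ℂ)
      (P : (W.baseChange K).toAffine.Point),
      W.conductorNorm ℤ = N → IsImaginaryQuadratic K → Odd (NumberField.discr K) →
      NumberField.discr K < -4 → SatisfiesHeegnerHypothesis N K → SatisfiesHeegnerHypothesis p K →
      (W.quadraticTwist (NumberField.discr K : ℚ)).entireLFunction 1 ≠ 0 →
      WeierstrassCurve.Affine.Point.map ι.toRatAlgHom P = heegnerPointComplex Dt H →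
      ¬ (p : ℤ) ∣ Dt.c → X11b.IndexLowerBoundAt W p K P) :
    BSDp W p := by
  obtain ⟨-, hp5, hgood, hord, hirr, -⟩ := id hX9
  have hpP : p.Prime := Fact.out
  have hp2 : p ≠ 2 := by omega
  have hordW : GoodOrd W p := ⟨hgood, hord⟩
  haveI : NeZero (W.conductorNorm ℤ) := ⟨(W.conductorNorm_pos_holds).ne'⟩
  -- the sign of the functional equation is `−1` (modularity, `r_an = 1`)
  have hw : W.rootNumber = -1 := by
    rw [WeierstrassCurve.rootNumber_eq_neg_one_pow_analyticRank_of_exists_isNewformOf hnf W, hr]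
    norm_num
  -- the field (Hoffstein–Luo): `d_K ≡ 1 (mod 8)`, `d_K < −4`, every `ℓ ∣ N` and `p` split,
  -- `L(E^{d_K},1) ≠ 0`
  obtain ⟨K, _, _, hK, hodd, hlt, hHN, hHp, hLt⟩ :=
    exists_admissibleField_of_rootNumber_eq_neg_one hnf hHL W hw p
  -- `p ∤ d_K` (`p` splits) and `w_K = 2`, prime to `p`
  have hpd : ¬ (p : ℤ) ∣ NumberField.discr K := not_dvd_discr_of_split hK hpP hp2 hHp
  have hμ : ¬ p ∣ Units.torsionOrder K := by
    haveI : IsTotallyComplex K := hK.2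
    rw [Literature.NumberTheory.DiophantineGeometry.torsionOrder_eq_two_of_discr_lt hK.1 hlt]
    intro hdvd
    have := Nat.le_of_dvd two_pos hdvd
    omega
  -- the Manin-unit Heegner datum at the good prime `p`
  obtain ⟨Dt, H, ι, P, hP, hc⟩ :=
    X11b.exists_maninDatum_of_good hnf hMaz hNS W p (W.conductorNorm ℤ) K rfl hp2 hgood hirr hK hHN
  -- a globally minimal model of the twist (Néron) and the X9 transports
  have hD0 : (NumberField.discr K : ℚ) ≠ 0 := by exact_mod_cast NumberField.discr_ne_zero K
  haveI hEt : (W.quadraticTwist (NumberField.discr K : ℚ)).IsElliptic :=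
    W.isElliptic_quadraticTwist hD0
  obtain ⟨Cd, hCd⟩ := hasGlobalMinimalModel_rat_holds (W.quadraticTwist (NumberField.discr K : ℚ))
  haveI : (Cd • W.quadraticTwist (NumberField.discr K : ℚ)).IsGloballyMinimal := hCd
  have hWd : Cd • W.quadraticTwist (NumberField.discr K : ℚ) =
      Cd • W.quadraticTwist (NumberField.discr K : ℚ) := rfl
  have hX9d : ClassX9 (Cd • W.quadraticTwist (NumberField.discr K : ℚ)) p :=
    classX9_twist_model hX9 K hK.1 hpd Cd hWd
  have hordd : GoodOrd (Cd • W.quadraticTwist (NumberField.discr K : ℚ)) p :=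
    ⟨hX9d.2.2.1, hX9d.2.2.2.1⟩
  have htam : padicValNat p (Cd • W.quadraticTwist (NumberField.discr K : ℚ)).tamagawaProduct =
      padicValNat p W.tamagawaProduct :=
    X2.padicValNat_tamagawaProduct_twist_of_heegner_of_odd W p hp2 K hK hodd hpd hHN Cd hWd
  have hu : padicValRat p (Cd.u : ℚ) = 0 :=
    X11b.padicValRat_u_eq_zero_of_twist_good W p hpd hgood Cd hWd hordd.1
  exact X9.bsdp_rankOne_of_indexLowerBoundAt_of_twist_mazurMainConjecture W p (W.conductorNorm ℤ) K
    Dt H ι P (hGZ _ W K) (hKo _ W K) (hMN _ W K) hGr hGZK hmod hpar hr hp2 hirr htam0 hK hlt hHN hP hc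
    hμ hLt (Cd • W.quadraticTwist (NumberField.discr K : ℚ)) Cd hWd hordd htam hu
    (mazurMainConjecture_of_integralMainConjectureOnClassX9 h5 hIMC hX9d)
    (hL _ K Dt H ι P rfl hK hodd hlt hHN hHp hLt hP hc)

/-! ### §5 With the anticyclotomic control link PUBLISHED (Jetchev–Skinner–Wan 2017 Thm. 3.3.1) -/

/-- **Rank one on class X9 at the pair, control PUBLISHED: the K6 typed rank-`0` engine +
Jetchev–Skinner–Wan 2017 Thm. 3.3.1 + the typed (IMC≥∘BDP)ᵍ + (irred_K) at the Heegner fields ⇒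
`BSD(E,p)`** — the X9 twin of `bsdp_rankOne_of_thm331_of_columnMainConjecture_odd`: STEP L at the
pair's Heegner data is fed by `X11b.indexLowerBoundAt_of_heegner_of_thm331_of_embedding` from the
published control theorem (`h331`, whose hypothesis (irred_𝒦) is the binder `hIrrK` — JSW's own; on
class X9 it follows from (irr_ℚ) by Matar–Nekovář 2019 Prop. 5.26 (2), companion file) and the ONE
typed anticyclotomic input `hLA` = (IMC≥∘BDP)ᵍ in the JSW/Castella letter
`X11b.IMCLowerWaldspurgerOnTreeGoodAt p κ (inducedPlace ι) γ ι P` — printed, on class X9, as BCS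
2025 Thm. 1.2.4 (a) + Prop. 4.2.2 + CGLS 2022 Thm. 5.1.3 (companion file `PrintX9HeegnerIMCLink.lean`).
[cite: BurungaleCastellaSkinner2025, Cor. 1.3.1 (r = 1) and its proof (p. 4); Thm. 1.2.4 (a); Prop. 4.2.2]
[cite: JetchevSkinnerWan2017, Thm. 3.3.1 with §3.5 (3.5.d)] [cite: MatarNekovar2019, Thm. 0.3, §0.11]
[cite: Miller2011LMS, Def. 1.1] -/
theorem X9.bsdp_rankOne_of_thm331_of_x9IntegralMainConjecture
    -- published inputs (named facts of the tree)
    (hGZ : ∀ (N : ℕ) [NeZero N] (W : WeierstrassCurve ℚ) (K : Type) [Field K] [NumberField K],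
      gross_zagier N W K)
    (hKo : ∀ (N : ℕ) [NeZero N] (W : WeierstrassCurve ℚ) (K : Type) [Field K] [NumberField K],
      kolyvagin N W K)
    (hMN : ∀ (N : ℕ) [NeZero N] (W : WeierstrassCurve ℚ) (K : Type) [Field K] [NumberField K],
      MatarNekovar2019.thm03_padicValNat_card_sha_le_of_irreducible N W K)
    (h331 : thm331_anticyclotomicControl)
    (hGr : greenberg_charValue_rankZero) (hGZK : rank_eq_analyticRank_of_analyticRank_le_one)
    (hmod : hasEntireLFunction_rat) (hpar : nonempty_modularParametrizationData)
    (hnf : exists_isNewformOf) (hHL : HoffsteinLuo1997_exists_twist_L_one_ne_zero)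
    (hMaz : mazur_not_dvd_maninConstant_of_odd) (hNS : integral_neronScaling_of_isGloballyMinimal)
    (h5 : realPeriodRat_eq_unit_mul_plusPeriod)
    -- the pair
    (W : WeierstrassCurve ℚ) [W.IsElliptic] [W.IsGloballyMinimal] (p : ℕ) [Fact p.Prime]
    (hX9 : ClassX9 W p) (hr : W.analyticRank = 1) (htam0 : ¬ p ∣ W.tamagawaProduct)
    -- the K6 typed rank-`0` engine (used at the twist only)
    (hIMC : IntegralMainConjectureOnClassX9)
    -- (irred_K) at the imaginary quadratic Heegner fields with `p` split — JSW's hypothesis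
    (hIrrK : ∀ (K : Type) [Field K] [NumberField K], IsImaginaryQuadratic K →
      SatisfiesHeegnerHypothesis (W.conductorNorm ℤ) K → SatisfiesHeegnerHypothesis p K →
      (W.baseChange K).HasIrreducibleModPGaloisRep p)
    -- (IMC≥∘BDP)ᵍ at this pair's classical Heegner data, JSW/Castella convention — the typed input
    (hLA : ∀ (N : ℕ) [NeZero N] (K : Type) [Field K] [NumberField K]
      (Dt : ModularParametrizationData W N) (H : HeegnerDatum N (NumberField.discr K)) (ιC : K →+* ℂ)
      (P : (W.baseChange K).toAffine.Point),
      W.conductorNorm ℤ = N → IsImaginaryQuadratic K → Odd (NumberField.discr K) →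
      NumberField.discr K < -4 → SatisfiesHeegnerHypothesis N K → SatisfiesHeegnerHypothesis p K →
      (W.quadraticTwist (NumberField.discr K : ℚ)).entireLFunction 1 ≠ 0 →
      WeierstrassCurve.Affine.Point.map ιC.toRatAlgHom P = heegnerPointComplex Dt H →
      ¬ (p : ℤ) ∣ Dt.c → ¬ IsOfFinAddOrder P →
      ∀ (κ : ZpExtension K p), κ.IsAnticyclotomic →
        ∀ (γ : Field.absoluteGaloisGroup K) [Fact (κ.IsTopGenerator γ)] (ι : K →+* ℚ_[p]),
          X11b.IMCLowerWaldspurgerOnTreeGoodAt p κ (X11b.inducedPlace ι) γ ι P) :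
    BSDp W p := by
  obtain ⟨-, hp5, hgood, hord, -, -⟩ := id hX9
  refine X9.bsdp_rankOne_of_indexLowerBoundAt_of_x9IntegralMainConjecture hGZ hKo hMN hGr hGZK hmod
    hpar hnf hHL hMaz hNS h5 W p hX9 hr htam0 hIMC ?_
  intro N _ K _ _ Dt H ιC P hN hK hodd hlt hHN hHp hLt hP hc
  -- the Heegner point is non-torsion (Gross–Zagier + modularity at `r_an = 1`)
  have hPinf : ¬ IsOfFinAddOrder P :=
    X11b.not_isOfFinAddOrder_of_heegner_of_analyticRank_eq_one W N K Dt H ιC P (hGZ N W K) hmod hr hK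
      hHN hLt hP
  -- (irred_K) at this field
  have hirrK : (W.baseChange K).HasIrreducibleModPGaloisRep p :=
    hIrrK K hK (by rw [hN]; exact hHN) hHp
  -- one anticyclotomic datum `(κ, γ)`, a prime `𝔭 ∣ p`, the embedding at `𝔭`, its induced prime
  obtain ⟨κ, γ, 𝔭, hκ, hγ, h𝔭⟩ := X11b.exists_anticyclotomic_generator_prime (p := p) hK
  haveI : Fact (κ.IsTopGenerator γ) := ⟨hγ⟩
  have hsplit : X11b.SplitsIn K p := hHp p Fact.out (dvd_refl p)
  obtain ⟨he, hf⟩ := X11b.degreeOne_of_splitsIn hK.1 hsplit h𝔭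
  set ι : K →+* ℚ_[p] := X11b.embAt K p 𝔭 h𝔭 he hf with hι
  exact X11b.indexLowerBoundAt_of_heegner_of_thm331_of_embedding W p N K Dt H ιC P h331 (hGZ N W K)
    (hKo N W K) hmod hGZK (by omega) hgood hr hN hK hHN hHp hirrK hLt hP hκ ι
    (hLA N K Dt H ιC P hN hK hodd hlt hHN hHp hLt hP hc hPinf κ hκ γ ι)

/-! ### §5c Both printed-shape inputs DISCHARGED: (irred_𝒦) by Matar–Nekovář 5.26 (2), (IMC≥∘BDP)ᵍ by BCS 1.2.4 (a) + 4.2.2 ∘ CGLS 5.1.3 -/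

/-- **Rank one on class X9 at the pair, `p ∤ ∏_ℓ c_ℓ(E)`, from PUBLISHED named facts and the K6
typed rank-`0` engine ALONE** — `X9.bsdp_rankOne_of_thm331_of_x9IntegralMainConjecture` with its two
printed-shape binders discharged: (irred_𝒦) at every imaginary quadratic `K` with the Heegner
hypothesis for `N_E` by Matar–Nekovář 2019 Prop. 5.26 (2) (`h526`; `(N_E, d_K) = 1` by
`Literature.SatisfiesHeegnerHypothesis.coprime_discr`, `p ≠ 2`, (irr_ℚ) from the class), and
(IMC≥∘BDP)ᵍ at every BCS Heegner datum by
`X11b.imcLowerWaldspurgerOnTreeGoodAt_inducedPlace_of_heegner_of_thm124a_of_thm331` (`h124a` =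
`thm124a_prop422_thm513_generator_constantCoeff`, `h331`, Kolyvagin `hKo`). Remaining inputs: the
published facts (binders) and `hIMC : IntegralMainConjectureOnClassX9` (the sister route's typed
rank-`0` engine; OPEN). NO Schneider, NO (im), NO (sur).
[cite: BurungaleCastellaSkinner2025, Thm. 1.2.4 (a), Prop. 4.2.2, Cor. 1.3.1 (proof, p. 4)]
[cite: MatarNekovar2019, Prop. 5.26 (2) (p. 492), Thm. 0.3, §0.11] [cite: JetchevSkinnerWan2017, Thm. 3.3.1]
[cite: CastellaGrossiLeeSkinner2022, Thm. 5.1.3] [cite: Miller2011LMS, Def. 1.1] -/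
theorem X9.bsdp_rankOne_of_thm331_of_thm124a_of_x9IntegralMainConjecture
    -- published inputs (named facts of the tree)
    (hGZ : ∀ (N : ℕ) [NeZero N] (W : WeierstrassCurve ℚ) (K : Type) [Field K] [NumberField K],
      gross_zagier N W K)
    (hKo : ∀ (N : ℕ) [NeZero N] (W : WeierstrassCurve ℚ) (K : Type) [Field K] [NumberField K],
      kolyvagin N W K)
    (hMN : ∀ (N : ℕ) [NeZero N] (W : WeierstrassCurve ℚ) (K : Type) [Field K] [NumberField K],
      MatarNekovar2019.thm03_padicValNat_card_sha_le_of_irreducible N W K)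
    (h526 : MatarNekovar2019.prop526_hasIrreducibleModPGaloisRep_baseChange)
    (h124a : thm124a_prop422_thm513_generator_constantCoeff)
    (h331 : thm331_anticyclotomicControl)
    (hGr : greenberg_charValue_rankZero) (hGZK : rank_eq_analyticRank_of_analyticRank_le_one)
    (hmod : hasEntireLFunction_rat) (hpar : nonempty_modularParametrizationData)
    (hnf : exists_isNewformOf) (hHL : HoffsteinLuo1997_exists_twist_L_one_ne_zero)
    (hMaz : mazur_not_dvd_maninConstant_of_odd) (hNS : integral_neronScaling_of_isGloballyMinimal)
    (h5 : realPeriodRat_eq_unit_mul_plusPeriod)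
    -- the pair
    (W : WeierstrassCurve ℚ) [W.IsElliptic] [W.IsGloballyMinimal] (p : ℕ) [Fact p.Prime]
    (hX9 : ClassX9 W p) (hr : W.analyticRank = 1) (htam0 : ¬ p ∣ W.tamagawaProduct)
    -- the K6 typed rank-`0` engine (used at the twist only)
    (hIMC : IntegralMainConjectureOnClassX9) : BSDp W p := by
  obtain ⟨-, hp5, hgood, hord, hirr, -⟩ := id hX9
  have hp2 : p ≠ 2 := by omega
  refine X9.bsdp_rankOne_of_thm331_of_x9IntegralMainConjecture hGZ hKo hMN h331 hGr hGZK hmod hpar hnf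
    hHL hMaz hNS h5 W p hX9 hr htam0 hIMC ?_ ?_
  · -- (irred_K) at every Heegner field, from (irr_ℚ): Matar–Nekovář 2019 Prop. 5.26 (2)
    intro K _ _ hK hHN _
    exact h526 W K hK.1 (Literature.SatisfiesHeegnerHypothesis.coprime_discr hK.1 hHN) p hp2 hirr
  · -- (IMC≥∘BDP)ᵍ at every BCS Heegner datum: BCS 1.2.4 (a) + 4.2.2 ∘ CGLS 5.1.3 + JSW 3.3.1
    intro N _ K _ _ Dt H ιC P hN hK hodd hlt hHN hHp hLt hP hc hPinf κ hκ γ _ ι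
    have hirrK : (W.baseChange K).HasIrreducibleModPGaloisRep p :=
      h526 W K hK.1 (by rw [hN]; exact Literature.SatisfiesHeegnerHypothesis.coprime_discr hK.1 hHN)
        p hp2 hirr
    exact X11b.imcLowerWaldspurgerOnTreeGoodAt_inducedPlace_of_heegner_of_thm124a_of_thm331 W p N K Dt
      H ιC P h124a h331 (hKo N W K) (by omega) ⟨hgood, hord⟩ hirr hirrK hN hK hodd hlt hHN hHp hP hc
      hPinf hκ ι

end Summit.BirchSwinnertonDyer.BirchSwinnertonDyer.Rank1Residual

end
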